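import Summits.CriticalPhenomena.PercolationContinuityZ3.Theorems.FK.Transplant.KNFreeSlabCasesO23T4
import HarnessLib

/-!
# FRONTIER TRANSPLANT, binder 2 (TP_FK) — T4-SLAB (L7): the interior FRAME of an inner contact and the arithmetic of the
# Y-COLUMN case (gate foot below the face of the flat direction, the face box beyond it, the fatness unit)

Support file (`--supports stmt-CriticalPhenomena-4575`, helper) of the FRONTIER TRANSPLANT sub-cell (`fk-continuity/transplant/`,
seat `prim-bschramm-fkt-p1`); builds on p205010 (kernel theorem, internal audit signed; external expert review pending).
0 definitions · 0 named facts · 0 sorries · standard axioms. File 9/18 of the bytes-first package (R60 (3)(β)) of the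
UNFUNDED memo row `T4-SLAB [g122, R60]` (re-described R62 (E)); proposable only on a coordinator ruling.
Registered R63 (cell INBOX l.4709, 2026-08-23); registry row T4s; lead label T4s-09 (fkt-lead L22, l.4677).

HONEST FRAMING (page 1, cell rule). The transplant's theorem of record `ufsc0_of_freeBoundaryHypothesis_r3` (p248245) is
CONDITIONAL on FH AND on TP_FK = `KNFreeTargetHittable d q p`, both OPEN at the same `p` for `q > 1` near `p_c(q)` (⇔ GRC Conj.
(5.103) via K1; barrier note `Literature.Barriers.CriticalPhenomena.SamePFreeBoundaryCriteria`, FBN-01, cited first); the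
transplant is a typed reduction, not a proof of FK continuity. THIS FILE: the interior FRAME of an inner contact (`inner_frame`: the exit, the lane slab and the look box sit inside
the level box minus its collar with room `2N` in every direction `≠ c`), non-adjacency of far exits
(`not_adj_of_two_le_abs`), and the arithmetic of the Y-COLUMN case — `Ycol_foot_facts` (the requested gate-foot
window), `exists_faceBox_unit` (a unit `N` with `L ≤ N ≤ Nbig` fitting the face box, `m⋆ ≥ 4`), `Ycol_wf_facts`,
`Ycol_faceBox_facts`. It proves nothing about either binder and says nothing at `p ↓ p_c(q)`; NOT `_r4`; `_r3` « 2 / 0 ☑ », n_open = 2,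
BINDER-OWNERS, FO-19 NO-GO unchanged.

Declarations: `not_adj_of_two_le_abs`, `inner_frame`, `Ycol_foot_facts`, `exists_faceBox_unit`, `Ycol_wf_facts`,
`Ycol_faceBox_facts`.

References: G. Grimmett, *The Random-Cluster Model*, Springer 2006, Thm. (3.1) eq. (3.4), Thm. (3.7), Thm. (3.8), Thm. (3.21)
eq. (3.22), Lemma (4.13), §5.7 [Grimmett2006]; G. Kozma, S. Nitzan, arXiv:2401.12397 (2024), §4 Lemma 10 Step IV (pp. 19–21) [KozmaNitzan2024].
-/

noncomputable section

namespace Summit.CriticalPhenomena.PercolationContinuityZ3.Theorems.FK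

open MeasureTheory
open scoped ENNReal Classical
open Literature.Probability.Percolation Literature.Probability.LatticeModels SimpleGraph
open Literature.Probability.Percolation.GadgetSystem Literature.Probability.Percolation.KozmaNitzan Transplant
open Literature.Barriers.CriticalPhenomena

variable {d : ℕ}

/-- Two sites differing by at least `2` in some coordinate are not lattice neighbours. [folklore] -/
theorem not_adj_of_two_le_abs {x y : Site d} (b : Fin d) (h : 2 ≤ |x b - y b|) : ¬ (zdGraph d).Adj x y := by
  intro hadj
  obtain ⟨j, hj | hj⟩ := (zdGraph_adj_iff x y).1 hadj
  · have := congrArg (fun f => f b) hj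
    simp only [Pi.add_apply] at this
    by_cases hjb : b = j
    · subst hjb; rw [Pi.single_eq_same] at this; rw [this] at h; norm_num [abs_le] at h
    · rw [Pi.single_eq_of_ne hjb] at this; rw [this] at h; norm_num at h
  · have := congrArg (fun f => f b) hj
    simp only [Pi.add_apply] at this
    by_cases hjb : b = j
    · subst hjb; rw [Pi.single_eq_same] at this; rw [this] at h; norm_num [abs_le] at h
    · rw [Pi.single_eq_of_ne hjb] at this; rw [this] at h; norm_num at h

/-- **Interior frame of an inner lane** (shared by the cases T4 / X / Y-column): from the window depths and the
fatness of the level box off the slab direction — the exit `z` lies in `U`, the interior slab box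
`INT ∩ U ∩ slab` is `2·Nbig`-fat off `c` and contains `x₁ = z ∓ σe_i`, the slab lies in the interior `c`-range and in
`U`'s `c`-range, and `v` is `M+1`-deep in every direction. [folklore] -/
theorem inner_frame (Lo Hi : Site d) (i : Fin d) (σ yi : ℤ) (hface : (σ = 1 ∧ yi = Hi i) ∨ (σ = -1 ∧ yi = Lo i))
    (M₀ M T L : ℕ) (hM₀ : M₀ + L + T ≤ M) (v : Site d) (hvi : v i = yi - σ * ((M : ℤ) + 1))
    (hvb : ∀ b, b ≠ i → Lo b + M + 1 ≤ v b ∧ v b ≤ Hi b - M - 1)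
    (ℓ : ℕ) (g : Geom d) (hloQ : ∀ b, g.loQ b ≤ -1) (hhiQ : ∀ b, 1 ≤ g.hiQ b)
    (c : Fin d) (hci : c ≠ i) (ζ : ℤ) (hζv : |ζ - v c| ≤ M₀)
    (z : Site d) (hzi : z i = yi - σ * T) (hzv : ∀ b, b ≠ i → |z b - v b| ≤ M₀)
    (Nbig : ℕ) (hℓ : (M : ℤ) + 2 * T + 2 * Nbig + 2 * L + 4 ≤ ℓ)
    (hfatX : ∀ b, b ≠ c → Lo b + 2 * M + 2 * T + 2 * Nbig + 4 ≤ Hi b) :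
    z ∈ g.Qset ℓ v ∧
    (∀ b, b ≠ c → max (Lo b + T + 1) (v b + ℓ * g.loQ b) + 2 * (Nbig : ℤ) ≤ min (Hi b - T - 1) (v b + ℓ * g.hiQ b)) ∧
    (v c + ℓ * g.loQ c ≤ ζ - L ∧ ζ + L ≤ v c + ℓ * g.hiQ c) ∧
    (Lo c + T + 1 ≤ ζ - L ∧ ζ + L ≤ Hi c - T - 1) ∧
    (∀ b, b ≠ c → max (Lo b + T + 1) (v b + ℓ * g.loQ b) ≤ Function.update z i (yi - σ * ((T : ℤ) + 1)) b ∧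
      Function.update z i (yi - σ * ((T : ℤ) + 1)) b ≤ min (Hi b - T - 1) (v b + ℓ * g.hiQ b)) ∧
    |yi - σ * ((T : ℤ) + 1) - v i| ≤ (M : ℤ) ∧
    (∀ b, Lo b + M + 1 ≤ v b ∧ v b ≤ Hi b - M - 1) := by
  have hℓ0 : (0 : ℤ) ≤ ℓ := Nat.cast_nonneg ℓ
  have hA : ∀ b, (ℓ : ℤ) * g.loQ b ≤ -ℓ := fun b => by
    have := mul_le_mul_of_nonneg_left (hloQ b) hℓ0; linarith
  have hB : ∀ b, (ℓ : ℤ) ≤ ℓ * g.hiQ b := fun b => by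
    have := mul_le_mul_of_nonneg_left (hhiQ b) hℓ0; linarith
  have hM₀' : (M₀ : ℤ) + L + T ≤ M := by exact_mod_cast hM₀
  have hL0 : (0 : ℤ) ≤ L := Nat.cast_nonneg L
  have hT0 : (0 : ℤ) ≤ T := Nat.cast_nonneg T
  have hN0 : (0 : ℤ) ≤ Nbig := Nat.cast_nonneg Nbig
  have hzv' : ∀ b, b ≠ i → v b - M₀ ≤ z b ∧ z b ≤ v b + M₀ := fun b hb => by
    have := hzv b hb; rw [abs_le] at this; constructor <;> linarith [this.1, this.2]
  have hζv' : v c - M₀ ≤ ζ ∧ ζ ≤ v c + M₀ := by rw [abs_le] at hζv; constructor <;> linarith [hζv.1, hζv.2]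
  have hvIn : ∀ b, Lo b + M + 1 ≤ v b ∧ v b ≤ Hi b - M - 1 := by
    intro b
    by_cases hb : b = i
    · have hfi := hfatX i hci.symm
      rw [hb]
      rcases hface with ⟨hσ, hy⟩ | ⟨hσ, hy⟩
      · rw [hvi, hσ, hy]; constructor <;> linarith
      · rw [hvi, hσ, hy]; constructor <;> linarith
    · exact hvb b hb
  have hx1i : Lo i + T + 1 ≤ yi - σ * ((T : ℤ) + 1) ∧ yi - σ * ((T : ℤ) + 1) ≤ Hi i - T - 1 ∧
      |yi - σ * ((T : ℤ) + 1) - v i| ≤ (M : ℤ) := by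
    have hfi := hfatX i hci.symm
    rcases hface with ⟨hσ, hy⟩ | ⟨hσ, hy⟩
    · rw [hσ, hy] at hvi ⊢; rw [hvi]; refine ⟨by linarith, by linarith, ?_⟩; rw [abs_le]; constructor <;> linarith
    · rw [hσ, hy] at hvi ⊢; rw [hvi]; refine ⟨by linarith, by linarith, ?_⟩; rw [abs_le]; constructor <;> linarith
  obtain ⟨hx1i1, hx1i2, hx1v⟩ := hx1i
  refine ⟨mem_Qset_of_forall fun b => ?_, fun b hbc => ?_, ⟨by linarith [hζv'.1, hA c], by linarith [hζv'.2, hB c]⟩,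
    ⟨by linarith [hζv'.1, (hvb c hci).1], by linarith [hζv'.2, (hvb c hci).2]⟩, fun b hbc => ?_, hx1v, hvIn⟩
  · by_cases hb : b = i
    · rw [hb, hzi, hvi]
      rcases hface with ⟨hσ, -⟩ | ⟨hσ, -⟩ <;> rw [hσ] <;> constructor <;> linarith [hA i, hB i]
    · constructor <;> linarith [hzv' b hb, hA b, hB b]
  · have hfb := hfatX b hbc
    have hv := hvIn b
    exact max_add_le_min (by linarith) (by linarith [hB b]) (by linarith [hA b]) (by linarith [hA b, hB b])
  · by_cases hb : b = i
    · rw [hb, Function.update_self]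
      refine ⟨max_le hx1i1 ?_, le_min hx1i2 ?_⟩
      · rw [abs_le] at hx1v; linarith [hA i]
      · rw [abs_le] at hx1v; linarith [hB i]
    · rw [Function.update_of_ne hb]
      have := hvb b hb
      exact ⟨max_le (by linarith [hzv' b hb]) (by linarith [hzv' b hb, hA b]),
        le_min (by linarith [hzv' b hb]) (by linarith [hzv' b hb, hB b])⟩

/-- **The gate foot of a Y-column lane**: its `a`-coordinate `ya - τa(T+1)` lies in the interior and `U`-ranges, is
within `ℓ(hiQ_a - loQ_a) + 2M` of `x₁`'s, and the gate top `ya - τa` is at least `2` away from the exit's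
`a`-coordinate (coordinate arithmetic of the cases `a ≠ i` / `a = i`). [folklore] -/
theorem Ycol_foot_facts (Lo Hi : Site d) (i : Fin d) (σ yi : ℤ) (hface : (σ = 1 ∧ yi = Hi i) ∨ (σ = -1 ∧ yi = Lo i))
    (M₀ M T : ℕ) (hM₀ : M₀ + 2 ≤ M) (hTM : T ≤ M) (v : Site d) (hvi : v i = yi - σ * ((M : ℤ) + 1))
    (hvb : ∀ b, b ≠ i → Lo b + M + 1 ≤ v b ∧ v b ≤ Hi b - M - 1)
    (ℓ : ℕ) (a : Fin d) (A B ca : ℤ) (hcaQ : v a + A ≤ ca ∧ ca ≤ v a + B) (hA : A ≤ -ℓ) (hB : (ℓ : ℤ) ≤ B)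
    (z : Site d) (hzi : z i = yi - σ * T) (hza : a ≠ i → |z a - v a| ≤ M₀)
    (Nbig mstar : ℕ) (hm : B - A + 2 * M + 2 ≤ (mstar : ℤ) * Nbig)
    (hfatA : Lo a + 2 * M + 2 * T + 2 * Nbig + 4 ≤ Hi a)
    (τa ya : ℤ) (hfaceA : (τa = 1 ∧ ya = Hi a) ∨ (τa = -1 ∧ ya = Lo a)) (haiτ : a = i → τa = -σ)
    (hcol : 1 ≤ τa * (ca - ya) + ((T : ℤ) + 1)) :
    Lo a + T + 1 ≤ ya - τa * ((T : ℤ) + 1) ∧ ya - τa * ((T : ℤ) + 1) ≤ Hi a - T - 1 ∧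
    v a + A ≤ ya - τa * ((T : ℤ) + 1) ∧ ya - τa * ((T : ℤ) + 1) ≤ v a + B ∧
    |Function.update z i (yi - σ * ((T : ℤ) + 1)) a - (ya - τa * ((T : ℤ) + 1))| ≤ (mstar : ℤ) * Nbig ∧
    2 ≤ |z a - (ya - τa)| := by
  have hM₀' : (M₀ : ℤ) + 2 ≤ M := by exact_mod_cast hM₀
  have hTM' : (T : ℤ) ≤ M := by exact_mod_cast hTM
  have hT0 : (0 : ℤ) ≤ T := Nat.cast_nonneg T
  have hN0 : (0 : ℤ) ≤ Nbig := Nat.cast_nonneg Nbig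
  by_cases hai : a = i
  · -- the column is on the face opposite to the contact
    have hτ := haiτ hai
    subst hai
    rw [Function.update_self]
    rcases hface with ⟨hσ, hy⟩ | ⟨hσ, hy⟩
    · have hτ' : τa = -1 := by rw [hτ, hσ]
      have hya : ya = Lo a := by
        rcases hfaceA with ⟨h, _⟩ | ⟨_, h⟩
        · rw [hτ'] at h; norm_num at h
        · exact h
      rw [hτ', hya] at hcol ⊢; rw [hσ, hy] at hvi hzi ⊢; rw [hzi]
      refine ⟨by linarith, by linarith, by linarith, by linarith, ?_, ?_⟩
      · rw [abs_le]; constructor <;> linarith [hcaQ.1, hcaQ.2]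
      · rw [le_abs]; left; linarith
    · have hτ' : τa = 1 := by rw [hτ, hσ]; norm_num
      have hya : ya = Hi a := by
        rcases hfaceA with ⟨_, h⟩ | ⟨h, _⟩
        · exact h
        · rw [hτ'] at h; norm_num at h
      rw [hτ', hya] at hcol ⊢; rw [hσ, hy] at hvi hzi ⊢; rw [hzi]
      refine ⟨by linarith, by linarith, by linarith, by linarith, ?_, ?_⟩
      · rw [abs_le]; constructor <;> linarith [hcaQ.1, hcaQ.2]
      · rw [le_abs]; right; linarith
  · rw [Function.update_of_ne hai]
    have hva := hvb a hai
    have hza' : v a - M₀ ≤ z a ∧ z a ≤ v a + M₀ := by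
      have := hza hai; rw [abs_le] at this; constructor <;> linarith [this.1, this.2]
    rcases hfaceA with ⟨hτ, hy⟩ | ⟨hτ, hy⟩
    · rw [hτ, hy] at hcol ⊢
      refine ⟨by linarith, by linarith, by linarith, by linarith [hcaQ.2], ?_, ?_⟩
      · rw [abs_le]; constructor <;> linarith [hcaQ.1, hcaQ.2]
      · rw [le_abs]; right; linarith
    · rw [hτ, hy] at hcol ⊢
      refine ⟨by linarith, by linarith, by linarith [hcaQ.1], by linarith, ?_, ?_⟩
      · rw [abs_le]; constructor <;> linarith [hcaQ.1, hcaQ.2]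
      · rw [le_abs]; left; linarith

/-- Fatness unit for a short face box: for a travel distance `D ≥ 2L+3` with `D ≤ mstar·Nbig` there is `N₂` with
`L ≤ N₂ ≤ ℓ`, `2N₂ + 1 ≤ D` and `D ≤ mstar·N₂` (`N₂ = Nbig` if `D > 2·Nbig`, else `⌊(D-1)/2⌋`). [folklore] -/
theorem exists_faceBox_unit (L Nbig mstar ℓ : ℕ) (hm3 : 4 ≤ mstar) (hNℓ : Nbig ≤ ℓ) (hLN : L ≤ Nbig)
    (D : ℤ) (hD : 2 * (L : ℤ) + 3 ≤ D) (hDm : D ≤ (mstar : ℤ) * Nbig) :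
    ∃ N₂ : ℕ, L ≤ N₂ ∧ N₂ ≤ ℓ ∧ 2 * (N₂ : ℤ) + 1 ≤ D ∧ D ≤ (mstar : ℤ) * N₂ := by
  have hm3' : (3 : ℤ) ≤ mstar := by have : (4 : ℤ) ≤ mstar := (by exact_mod_cast hm3); linarith
  rcases le_or_gt (2 * (Nbig : ℤ) + 1) D with h | h
  · exact ⟨Nbig, hLN, hNℓ, h, hDm⟩
  · obtain ⟨K, hK⟩ : ∃ K : ℕ, (K : ℤ) = (D - 1) / 2 := ⟨((D - 1) / 2).toNat, Int.toNat_of_nonneg (by omega)⟩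
    have hL' : (L : ℤ) ≤ (D - 1) / 2 := by omega
    have hKN : (D - 1) / 2 ≤ (Nbig : ℤ) := by omega
    have hNℓ' : (Nbig : ℤ) ≤ ℓ := by exact_mod_cast hNℓ
    have h2K : 2 * ((D - 1) / 2) + 1 ≤ D := by omega
    rw [← hK] at h2K
    refine ⟨K, by rw [← hK] at hL'; exact_mod_cast hL', ?_, h2K, ?_⟩
    · have : (K : ℤ) ≤ ℓ := by rw [hK]; linarith
      exact_mod_cast this
    · have h3 : D ≤ 4 * ((D - 1) / 2) := by omega
      rw [← hK] at h3
      have hm4 : (4 : ℤ) ≤ mstar := by exact_mod_cast hm3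
      have h4 := mul_le_mul_of_nonneg_right hm4 (Nat.cast_nonneg K : (0 : ℤ) ≤ K)
      linarith


/-- **The gate foot's transverse coordinates** (Y-column case): requested in the window `[r_b, r_b + G]`,
`r_b = v_b` if `F` extends upward in `b` else `v_b - G`, they lie in `I_b ∩ [v_b - G, v_b + G]`, inside the interior
slab box, and within `mstar·Nbig` of `x₁`. [folklore] -/
theorem Ycol_wf_facts (Lo Hi : Site d) (i : Fin d) (σ yi : ℤ) (M₀ M T G : ℕ) (hGM : G ≤ M₀) (hM₀ : M₀ + T + 2 ≤ M)
    (v : Site d) (hvIn : ∀ b, Lo b + M + 1 ≤ v b ∧ v b ≤ Hi b - M - 1)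
    (ℓ : ℕ) (g : Geom d) (hloQ : ∀ b, g.loQ b ≤ -1) (hhiQ : ∀ b, 1 ≤ g.hiQ b) (hGℓ : (G : ℤ) ≤ ℓ)
    (a : Fin d) (hF0 : ∀ b, b ≠ a → g.loF b ≤ 0 ∧ 0 ≤ g.hiF b) (hF1 : ∀ b, b ≠ a → g.loF b + 1 ≤ g.hiF b)
    (c : Fin d) (z : Site d) (hzv : ∀ b, b ≠ i → |z b - v b| ≤ M₀) (hx1v : |yi - σ * ((T : ℤ) + 1) - v i| ≤ (M : ℤ))
    (Nbig mstar : ℕ) (hm : ∀ b, (ℓ : ℤ) * g.hiQ b - ℓ * g.loQ b + 2 * M + 2 ≤ (mstar : ℤ) * Nbig)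
    (τa ya : ℤ) (wf : Site d) (hwfa : wf a = ya - τa * ((T : ℤ) + 1))
    (hfa1 : Lo a + T + 1 ≤ ya - τa * ((T : ℤ) + 1)) (hfa2 : ya - τa * ((T : ℤ) + 1) ≤ Hi a - T - 1)
    (hfaQ1 : v a + ℓ * g.loQ a ≤ ya - τa * ((T : ℤ) + 1)) (hfaQ2 : ya - τa * ((T : ℤ) + 1) ≤ v a + ℓ * g.hiQ a)
    (hdista : |Function.update z i (yi - σ * ((T : ℤ) + 1)) a - (ya - τa * ((T : ℤ) + 1))| ≤ (mstar : ℤ) * Nbig)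
    (hwfr : ∀ b, b ≠ a → b ≠ c →
      (fun b => if 1 ≤ g.hiF b then v b else v b - G) b ≤ wf b ∧ wf b ≤ (fun b => if 1 ≤ g.hiF b then v b else v b - G) b + G) :
    (∀ b, b ≠ a → b ≠ c → v b - G ≤ wf b ∧ wf b ≤ v b + G ∧ v b + ℓ * g.loF b ≤ wf b ∧ wf b ≤ v b + ℓ * g.hiF b) ∧
    (∀ b, b ≠ c → max (Lo b + T + 1) (v b + ℓ * g.loQ b) ≤ wf b ∧ wf b ≤ min (Hi b - T - 1) (v b + ℓ * g.hiQ b)) ∧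
    (∀ b, b ≠ c → |Function.update z i (yi - σ * ((T : ℤ) + 1)) b - wf b| ≤ (mstar : ℤ) * Nbig) := by
  have hℓ0 : (0 : ℤ) ≤ ℓ := Nat.cast_nonneg ℓ
  have hA : ∀ b, (ℓ : ℤ) * g.loQ b ≤ -ℓ := fun b => by
    have := mul_le_mul_of_nonneg_left (hloQ b) hℓ0; linarith
  have hB : ∀ b, (ℓ : ℤ) ≤ ℓ * g.hiQ b := fun b => by
    have := mul_le_mul_of_nonneg_left (hhiQ b) hℓ0; linarith
  have hF0' : ∀ b, b ≠ a → (ℓ : ℤ) * g.loF b ≤ 0 ∧ 0 ≤ (ℓ : ℤ) * g.hiF b := fun b hb =>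
    ⟨mul_nonpos_of_nonneg_of_nonpos hℓ0 (hF0 b hb).1, mul_nonneg hℓ0 (hF0 b hb).2⟩
  have hGM' : (G : ℤ) ≤ M₀ := by exact_mod_cast hGM
  have hM₀' : (M₀ : ℤ) + T + 2 ≤ M := by exact_mod_cast hM₀
  have hG0 : (0 : ℤ) ≤ G := Nat.cast_nonneg G
  have hT0 : (0 : ℤ) ≤ T := Nat.cast_nonneg T
  have hwfb : ∀ b, b ≠ a → b ≠ c → v b - G ≤ wf b ∧ wf b ≤ v b + G ∧
      v b + ℓ * g.loF b ≤ wf b ∧ wf b ≤ v b + ℓ * g.hiF b := by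
    intro b hba hbc
    have hw := hwfr b hba hbc
    by_cases h1 : 1 ≤ g.hiF b
    · simp only [if_pos h1] at hw
      have : (ℓ : ℤ) ≤ ℓ * g.hiF b := by have := mul_le_mul_of_nonneg_left h1 hℓ0; linarith
      exact ⟨by linarith, by linarith, by linarith [hF0' b hba], by linarith⟩
    · simp only [if_neg h1] at hw
      have h2 : g.loF b ≤ -1 := by have := hF1 b hba; have := (hF0 b hba).2; omega
      have : (ℓ : ℤ) * g.loF b ≤ -ℓ := by have := mul_le_mul_of_nonneg_left h2 hℓ0; linarith
      exact ⟨by linarith, by linarith, by linarith, by linarith [hF0' b hba]⟩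
  refine ⟨hwfb, fun b hbc => ?_, fun b hbc => ?_⟩
  · by_cases hba : b = a
    · rw [hba, hwfa]; exact ⟨max_le hfa1 hfaQ1, le_min hfa2 hfaQ2⟩
    · have hw := hwfb b hba hbc
      have hv := hvIn b
      exact ⟨max_le (by linarith) (by linarith [hA b]), le_min (by linarith) (by linarith [hB b])⟩
  · by_cases hba : b = a
    · rw [hba, hwfa]; exact hdista
    · have hw := hwfb b hba hbc
      by_cases hb : b = i
      · have hmi := hm i
        rw [hb, Function.update_self]; rw [hb] at hw
        rw [abs_le] at hx1v ⊢; constructor <;> linarith [hA i, hB i]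
      · have hmb := hm b
        rw [Function.update_of_ne hb]
        have hz := hzv b hb; rw [abs_le] at hz
        rw [abs_le]; constructor <;> linarith [hA b, hB b]

/-- **The face box beyond the column's face** (Y-column case, sub-case IC-B): endpoints, outwardness, the first
beyond vertex and the target's `a`-coordinate inside it, its length `≥ s - T - 3`, and the travel `s - T - 2`.
[folklore] -/
theorem Ycol_faceBox_facts (Lo Hi v : Site d) (a : Fin d) (T : ℕ) (A B ca : ℤ) (hcaQ : v a + A ≤ ca ∧ ca ≤ v a + B)
    (τa ya : ℤ) (hfaceA : (τa = 1 ∧ ya = Hi a) ∨ (τa = -1 ∧ ya = Lo a))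
    (hfaQ1 : v a + A ≤ ya - τa * ((T : ℤ) + 1)) (hfaQ2 : ya - τa * ((T : ℤ) + 1) ≤ v a + B)
    (s : ℤ) (hs : s = τa * (ca - ya) + ((T : ℤ) + 1)) (hsB : (T : ℤ) + 2 < s) :
    v a + A ≤ (if τa = 1 then ya + 1 else v a + A) ∧ (if τa = 1 then v a + B else ya - 1) ≤ v a + B ∧
    (∀ w : ℤ, (if τa = 1 then ya + 1 else v a + A) ≤ w → w ≤ (if τa = 1 then v a + B else ya - 1) →
      0 ≤ τa * (w - ya)) ∧
    ((if τa = 1 then ya + 1 else v a + A) ≤ ya + τa ∧ ya + τa ≤ (if τa = 1 then v a + B else ya - 1)) ∧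
    ((if τa = 1 then ya + 1 else v a + A) ≤ ca ∧ ca ≤ (if τa = 1 then v a + B else ya - 1)) ∧
    (if τa = 1 then ya + 1 else v a + A) + (s - T - 3) ≤ (if τa = 1 then v a + B else ya - 1) ∧
    |ya + τa - ca| ≤ s - T - 2 ∧ s - T - 2 ≤ B - A := by
  have hT0 : (0 : ℤ) ≤ T := Nat.cast_nonneg T
  rcases hfaceA with ⟨hτ, hy⟩ | ⟨hτ, hy⟩
  · simp only [hτ, if_true]
    rw [hτ] at hs hfaQ1 hfaQ2
    have hs' : s = ca - ya + (T + 1) := by rw [hs]; ring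
    refine ⟨by linarith, le_rfl, fun w hw _ => by linarith, ⟨le_rfl, by linarith [hcaQ.2]⟩, ⟨by linarith, hcaQ.2⟩,
      by linarith [hcaQ.2], ?_, by linarith [hcaQ.1, hcaQ.2]⟩
    rw [abs_le]; constructor <;> linarith
  · simp only [hτ, show (-1 : ℤ) ≠ 1 by norm_num, if_false]
    rw [hτ] at hs hfaQ1 hfaQ2
    have hs' : s = ya - ca + (T + 1) := by rw [hs]; ring
    refine ⟨le_rfl, by linarith, fun w _ hw => by linarith, ⟨by linarith [hcaQ.1], by linarith⟩, ⟨hcaQ.1, by linarith⟩,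
      by linarith [hcaQ.1], ?_, by linarith [hcaQ.1, hcaQ.2]⟩
    rw [abs_le]; constructor <;> linarith

end Summit.CriticalPhenomena.PercolationContinuityZ3.Theorems.FK

end
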